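import Summits.QuantumFields.YangMills.Theses.ConvexGribovBody
import Summits.QuantumFields.YangMills.Theorems.ConvexGribovBodyPoincareToGapProjectionBoundsToRetention
import Summits.QuantumFields.YangMills.Theorems.ConvexGribovBodyPoincareToGapRetentionToGap

/-!
# Typed decomposition of crux `ConvexGribovBody.PoincareToGap` (stmt-QuantumFields-8781) into its two
open cores: one-slice projection bound ∧ conditional projection bound ⇒ the crux, BY NAME

Strategist split (planner `cstrat-stmt-QuantumFields-8781-s1`, 2026-08-17).  The cyclic-peeling line
(`Cruxes/PoincareToGap/Lines/Sketch.lean`, leads 0 / c1 / c2) has reduced the crux, kernel-checked, to exactly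
two open statements, the registered stubs

* `Sub₁ = OneSliceProjectionBound` (PB1): the crux hypothesis (time-zero slice Poincaré inequality with
  constant `κ` on all tori `S ≥ S₀`, restated without `let`) implies that for some `θ₁ < 1` and all large tori
  the spatial links `X_s` of ONE time slice carry at most the fraction `θ₁` of the variance of every bounded
  measurable gauge-invariant `h` reading links other than `X_s`:  `Var(E_μ[h | X_s]) ≤ θ₁ · Var h`;
* `Sub₂ = ConditionalProjectionBound` (PB2): the same hypothesis implies that for some `θ₂ < 1`, on all large
  tori, for every time arc of `ℓ` slices (`3 ≤ ℓ`, `ℓ + 3 ≤ 2S+1`) from `s` and every bounded measurable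
  gauge-invariant `h` reading only links outside the arc, the far end slice adds at most the fraction `θ₂` of
  the residual variance given the near end slice:
  `‖E[h | X_s ∪ X_{s+ℓ-1}] − E[h | X_s]‖² ≤ θ₂ · ‖h − E[h | X_s]‖²`.

`PoincareToGap_of_subs : Sub₁ → Sub₂ → ConvexGribovBody.PoincareToGap` is the sorry-free composition of the
two LANDED hypothesis-free halves of the line: `stub_twoTimeRetention_of_projectionBounds` (PB1 ∧ PB2 ⇒
two-time arc retention with `ε = (1−θ₁)(1−θ₂)`, p132792: glue p106765 + duality p104460) and
`stub_gapAt_of_twoTimeRetention` (retention ⇒ the clustering body, p122459: kernel versions p98435 + peeling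
p100144 + assembly p101620).  Both antecedents are spelled out verbatim (they are the registered stub
signatures of `Lines/Sketch.lean`, `stub_oneSliceProjectionBound_of_slicePoincare` and
`stub_conditionalProjectionBound_of_slicePoincare`), so that the route-level split
`PoincareToGap ⟸ OneSliceProjectionBound ∧ ConditionalProjectionBound` can cite this theorem as its glue.

Neither child is the crux reworded: the crux's conclusion carries observable-dependent constants and does not
give a UNIFORM-in-`h` projection bound, so `Sub₁ ∧ Sub₂` is strictly stronger than the crux (uniform one-slice
`L²`-mixing of the thermal torus state in Euclidean time, resp. its version conditioned on a far slice —
knots K-a / K-b of `Cruxes/PoincareToGap/NOTES.md`); neither child alone gives the crux on the periodic torus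
(the complement of every arc has two boundary slices).

References: F. Martinelli, LNM 1717 (1999) §3; K. Osterwalder, E. Seiler, Ann. Phys. 110 (1978) §2;
P. Diaconis, L. Saloff-Coste, Ann. Appl. Probab. 3 (1993) (what the projection bounds replace).
-/

noncomputable section

open scoped BigOperators Topology
open MeasureTheory ProbabilityTheory Filter
open Literature.MathematicalPhysics.QuantumFieldTheory Literature.MathematicalPhysics.QuantumLattice

namespace Summit.QuantumFields.YangMills.Theorems.PoincareToGap

/-- **Strategist split of the crux**: one-slice projection bound (PB1) → conditional projection bound (PB2) →
`ConvexGribovBody.PoincareToGap`, by name.  PB1 and PB2 give `θ₁, θ₂ ∈ [0,1)` beyond `S₁, S₂`;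
`stub_twoTimeRetention_of_projectionBounds` turns them into two-time arc retention with
`ε = (1−θ₁)(1−θ₂) ∈ (0,1]` on all tori `S ≥ max S₁ S₂`, and `stub_gapAt_of_twoTimeRetention` returns the
crux's clustering body; the crux hypothesis (a `let`-cascade) is handed over by definitional unfolding. -/
theorem PoincareToGap_of_subs :
    (∀ (G : Type) [Group G] [TopologicalSpace G] [IsTopologicalGroup G] [CompactSpace G]
      [MeasurableSpace G] [BorelSpace G], IsCompactSimpleLieGroup G →
    ∀ (r : LatticeRep G) (β : ℝ), 0 < β → ∀ κ : ℝ, 0 < κ → ∀ S₀ : ℕ,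
    (∀ S : ℕ, S₀ ≤ S → ∀ f : GaugeConfig 4 (2 * S + 1) G → ℝ, IsGaugeInvariant f →
      (∀ U V : GaugeConfig 4 (2 * S + 1) G,
        (∀ e : Edge 4 (2 * S + 1), e.1 0 = 0 → e.2 ≠ 0 → U e = V e) → f U = f V) →
      (∃ K : ℝ, ∀ U V : GaugeConfig 4 (2 * S + 1) G,
        |f U - f V| ≤ K * ∑ e, Real.sqrt (∑ a, ∑ b, ‖(r.ρ (U e) - r.ρ (V e)) a b‖ ^ 2)) →
      ∫ U, (f U - ∫ V, f V ∂(wilsonMeasure r.ρ β : Measure (GaugeConfig 4 (2 * S + 1) G))) ^ 2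
          ∂(wilsonMeasure r.ρ β : Measure (GaugeConfig 4 (2 * S + 1) G)) ≤
        κ * ∑ e : Edge 4 (2 * S + 1), (if e.1 0 = 0 ∧ e.2 ≠ 0 then
          ∫ U, (Filter.limsup (fun g : G => |f (Function.update U e g) - f U| /
              Real.sqrt (∑ a, ∑ b, ‖(r.ρ g - r.ρ (U e)) a b‖ ^ 2)) (𝓝[≠] (U e))) ^ 2
            ∂(wilsonMeasure r.ρ β : Measure (GaugeConfig 4 (2 * S + 1) G)) else 0)) →
    ∃ θ₁ : ℝ, 0 ≤ θ₁ ∧ θ₁ < 1 ∧ ∃ S₁ : ℕ, ∀ S : ℕ, S₁ ≤ S →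
      ∀ μ : Measure (GaugeConfig 4 (2 * S + 1) G),
        μ = (wilsonMeasure r.ρ β : Measure (GaugeConfig 4 (2 * S + 1) G)) →
      ∀ (s : ZMod (2 * S + 1)) (h : GaugeConfig 4 (2 * S + 1) G → ℝ), Measurable h →
        (∃ M : ℝ, ∀ U, |h U| ≤ M) → IsGaugeInvariant h →
        DependsOn h {e : Edge 4 (2 * S + 1) | ¬ ((e.1 0 - s).val = 0 ∧ e.2 ≠ 0)} →
      ∫ U, (condExp (cylinderEvents {e : Edge 4 (2 * S + 1) | (e.1 0 - s).val = 0 ∧ e.2 ≠ 0}) μ h U -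
          ∫ V, h V ∂μ) ^ 2 ∂μ ≤ θ₁ * ∫ U, (h U - ∫ V, h V ∂μ) ^ 2 ∂μ) →
    (∀ (G : Type) [Group G] [TopologicalSpace G] [IsTopologicalGroup G] [CompactSpace G]
      [MeasurableSpace G] [BorelSpace G], IsCompactSimpleLieGroup G →
    ∀ (r : LatticeRep G) (β : ℝ), 0 < β → ∀ κ : ℝ, 0 < κ → ∀ S₀ : ℕ,
    (∀ S : ℕ, S₀ ≤ S → ∀ f : GaugeConfig 4 (2 * S + 1) G → ℝ, IsGaugeInvariant f →
      (∀ U V : GaugeConfig 4 (2 * S + 1) G,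
        (∀ e : Edge 4 (2 * S + 1), e.1 0 = 0 → e.2 ≠ 0 → U e = V e) → f U = f V) →
      (∃ K : ℝ, ∀ U V : GaugeConfig 4 (2 * S + 1) G,
        |f U - f V| ≤ K * ∑ e, Real.sqrt (∑ a, ∑ b, ‖(r.ρ (U e) - r.ρ (V e)) a b‖ ^ 2)) →
      ∫ U, (f U - ∫ V, f V ∂(wilsonMeasure r.ρ β : Measure (GaugeConfig 4 (2 * S + 1) G))) ^ 2
          ∂(wilsonMeasure r.ρ β : Measure (GaugeConfig 4 (2 * S + 1) G)) ≤
        κ * ∑ e : Edge 4 (2 * S + 1), (if e.1 0 = 0 ∧ e.2 ≠ 0 then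
          ∫ U, (Filter.limsup (fun g : G => |f (Function.update U e g) - f U| /
              Real.sqrt (∑ a, ∑ b, ‖(r.ρ g - r.ρ (U e)) a b‖ ^ 2)) (𝓝[≠] (U e))) ^ 2
            ∂(wilsonMeasure r.ρ β : Measure (GaugeConfig 4 (2 * S + 1) G)) else 0)) →
    ∃ θ₂ : ℝ, 0 ≤ θ₂ ∧ θ₂ < 1 ∧ ∃ S₁ : ℕ, ∀ S : ℕ, S₁ ≤ S →
      ∀ μ : Measure (GaugeConfig 4 (2 * S + 1) G),
        μ = (wilsonMeasure r.ρ β : Measure (GaugeConfig 4 (2 * S + 1) G)) →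
      ∀ (s : ZMod (2 * S + 1)) (ℓ : ℕ), 3 ≤ ℓ → ℓ + 3 ≤ 2 * S + 1 →
      ∀ h : GaugeConfig 4 (2 * S + 1) G → ℝ, Measurable h → (∃ M : ℝ, ∀ U, |h U| ≤ M) →
        IsGaugeInvariant h → DependsOn h {e : Edge 4 (2 * S + 1) | ℓ ≤ (e.1 0 - s).val} →
      ∫ U, (condExp (cylinderEvents {e : Edge 4 (2 * S + 1) |
              ((e.1 0 - s).val = 0 ∨ (e.1 0 - s).val = ℓ - 1) ∧ e.2 ≠ 0}) μ h U -
            condExp (cylinderEvents {e : Edge 4 (2 * S + 1) | (e.1 0 - s).val = 0 ∧ e.2 ≠ 0}) μ h U) ^ 2 ∂μ ≤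
        θ₂ * ∫ U, (h U -
            condExp (cylinderEvents {e : Edge 4 (2 * S + 1) | (e.1 0 - s).val = 0 ∧ e.2 ≠ 0}) μ h U) ^ 2 ∂μ) →
    Summit.QuantumFields.YangMills.Theses.ConvexGribovBody.PoincareToGap := by
  intro hPB1 hPB2 G _ _ _ _ _ _ hG r β hβ κ hκ S₀ hP
  obtain ⟨θ₁, h10, h11, S₁, h1⟩ := hPB1 G hG r β hβ κ hκ S₀ (fun S hS => hP S hS)
  obtain ⟨θ₂, h20, h21, S₂, h2⟩ := hPB2 G hG r β hβ κ hκ S₀ (fun S hS => hP S hS)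
  have hε0 : 0 < (1 - θ₁) * (1 - θ₂) := mul_pos (by linarith) (by linarith)
  have hε1 : (1 - θ₁) * (1 - θ₂) ≤ 1 := by nlinarith [mul_nonneg h10 h20]
  exact stub_gapAt_of_twoTimeRetention G r β ((1 - θ₁) * (1 - θ₂)) hε0 hε1 (max S₁ S₂)
    (stub_twoTimeRetention_of_projectionBounds G r β θ₁ θ₂ h10 h11 h20 h21 (max S₁ S₂)
      (fun S' hS' => h1 S' (le_trans (le_max_left _ _) hS'))
      (fun S' hS' => h2 S' (le_trans (le_max_right _ _) hS')))

end Summit.QuantumFields.YangMills.Theorems.PoincareToGap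

end
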